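import HarnessLib
import HarnessLib.Audit
import HarnessLib.Audit.TribunalTags

/-!
# Strong-Hypothesis Library — summit `FinalStateConjecture` (D-0034, skeleton)

The REGISTRY of known strong hypotheses `H` (open conjectures with `H ⇒ P` landed or printed) and of known
equivalent reformulations `E` (`E ↔ P` in print) for the single-problem summit `FinalStateConjecture`.
Entries would carry `@[strong_hypothesis "FinalStateConjecture.FinalStateConjecture"]`; the bridges live
summit-side in `Summits/FinalStateConjecture/StrongHypotheses.lean`.

**Result of the census: the registry is EMPTY.** The final state conjecture is the TOP of the printed
hierarchy of large-data conjectures for the vacuum Einstein equations: every named neighbouring conjecture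
in print (weak cosmic censorship, Kerr stability in the full sub-extremal range, strong cosmic censorship,
the Penrose inequality, black-hole rigidity without analyticity, non-existence of solitons, asymptotic
stationarity) is either a CONSEQUENCE / clause of it, an INGREDIENT of the expected proof (a route crux, which
the tribunal finds by its own scan of `Summits/…`), or INCOMPARABLE with it; no source states a hypothesis
`H` together with a proof of `H ⇒` "generic one-ended asymptotically flat vacuum data settle down to finitely
many sub-extremal Kerr black holes plus radiation", and no equivalent reformulation is printed. The only
strictly stronger statements are unnamed sharpenings of the conjecture itself (quantitative rates; dropping
genericity), recorded below as candidates. Both files of the pair therefore exist (docstring census +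
namespace) with zero tags and zero bridges, so the tribunal reports `no strong hypothesis registered` for this
summit rather than silently lacking a file. Nothing is restated; no new decl is introduced (the two-decl
budget is deliberately unspent: neither candidate is a famous printed conjecture with a printed bridge).

## The problem

* `FinalStateConjecture : Prop` (root, `Summits/FinalStateConjecture/FinalStateConjecture/Statement.lean`,
  `[problem: gr]`; Dafermos–Luk arXiv:1710.01722 §1.2.1 p. 8 "the more ambitious conjecture", Klainerman–Szeftel
  2023 p. 3, Christodoulou CQG 16 (1999) p. A24/A26–27, Penrose 1982 Problem 12): for every connected Hausdorff
  second-countable smooth `3`-manifold `Σ`, TAME-GENERICALLY (`InitialDataSet.IsTameChristodoulouGeneric … 1`,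
  exceptional set of positive tame codimension on one fixed AF end) in the admissible class
  `admissibleVacuumData Σ` (smooth complete one-ended AF vacuum constraint solutions with Dafermos–Rodnianski
  rates), the datum has an MGHD (`VacuumCauchyDevelopment … IsMaximal`) and every MGHD has complete `𝓘⁺`
  (`Summit.FinalStateConjecture.HasCompleteNullInfinity`, sojourn form) and settles down, on the self-determined
  exterior `O = J⁺(Σ) ∩ I⁻(charted)`, to an `N`-hole `FinalStateDecomposition` in `C²` by SUB-EXTREMAL boosted
  Kerr exteriors plus a flat radiation zone, with `RaysStayInClosure`, `HasExhaustiveCharts`, `IsFutureOriented`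
  (`N = 0` = dispersal).

## Census (candidates examined; H ⇒ P known in print, or E ⇔ P)

| `H` / `E` | one-line statement | relation to `FinalStateConjecture` | source | status here | bridge |
|---|---|---|---|---|---|
| weak cosmic censorship (vacuum, Christodoulou form) | generic admissible data have MGHDs with complete `𝓘⁺` | WEAKER — the first conclusion clause (tame genericity is monotone in the property: a witness family for `P ∧ Q` witnesses `P`) | Christodoulou CQG 16 (1999) p. A27; Dafermos–Luk §1.1.1 | in tree as `Literature.Geometry.Lorentzian.WeakCosmicCensorship` (`CosmicCensorship.lean`) — but over the OLDER `VacuumDevelopment` structure, which is UNINHABITED (`VacuumDevelopment.isEmpty`, `DevelopmentProofs.lean`), so that decl holds vacuously, and over the topology-free `IsChristodoulouGeneric`; deliberately NOT registered (weaker; and vacuous as typed) | — |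
| sub-extremal Kerr stability conjecture | vacuum data `ε`-close to Kerr data (`|a| < M`) have complete `𝓘⁺` and a d.o.c. converging to a nearby Kerr | INCOMPARABLE / INGREDIENT (all near-Kerr data vs. generic large data; FSC gives no parameter-nearness, Kerr stability says nothing far from Kerr); Dafermos–Luk state FSC as "more ambitious" than their Conj. 1 but prove no implication either way | Dafermos–Rodnianski Clay lectures Conj. 5.1; Dafermos–Luk Conj. 1; Klainerman–Szeftel 2023 (`|a| ≪ M`); DHRT 2021 (`a = 0`, codim 3) | in tree as the PARAMETRISED predicate `Literature.Geometry.Lorentzian.SubextremalKerrStabilityConjecture s δ k` (`Stability.lean`, again over `VacuumDevelopment`); NOT registered | none |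
| strong cosmic censorship, `C⁰` / `C²` forms | generic MGHDs are `C⁰`- (resp. `C²`-) inextendible | INCOMPARABLE (`C⁰` form expected FALSE given Kerr stability, Dafermos–Luk §1.3.3; `C²` form concerns the interior, FSC the exterior) | Penrose 1979; Christodoulou 1999 p. A28; Dafermos–Luk Conj. 2 | in tree (`…StrongCosmicCensorshipC0`, `…StrongCosmicCensorshipC2`, over `VacuumDevelopment`, vacuous as typed); NOT registered | none |
| Penrose inequality (spacetime form) | `√(|S|/16π) ≤ m_ADM` for outermost MOTS | WEAKER-in-spirit / INCOMPARABLE (Penrose's 1973 heuristic DERIVES it from WCC + settling to Kerr + area theorem; no converse) | Penrose 1973; Mars CQG 26 (2009) §2–3 | in tree (`Literature.Geometry.Lorentzian.PenroseInequalityConjecture`, `MassInequalities.lean`, with a recorded counterexample-in-form caveat; corrected `PenroseInequalityEnclosureConjecture`, `PenroseConjecture.lean`); NOT registered | none |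
| black-hole rigidity / uniqueness WITHOUT analyticity | a regular stationary AF vacuum black-hole exterior is a Kerr exterior | INGREDIENT (identifies the stationary end-state; a crux of every FSC route), does not imply FSC | Chruściel–Costa 2008 Conj. 1.2 / Thm. 1.3 (analytic); Alexakis–Ionescu–Klainerman 2010 (near-Kerr, smooth) | in tree as statement SCHEMAS `Literature.Geometry.Lorentzian.stationary_black_hole_uniqueness IsIPlusRegular`, `…AlexakisIonescuKlainermanRigidity IsRegularCloseToKerr` (`BlackHoles.lean`), `ChruscielCosta2008_uniqueness` (`StationaryBlackHoleUniqueness.lean`) — parametrised / literature facts; NOT registered | none |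
| non-existence of vacuum solitons | a geodesically complete stationary AF vacuum spacetime is flat | INGREDIENT and a THEOREM (Lichnerowicz; Anderson 2000), not an open hypothesis | Anderson 2000 | in tree as named facts `Anderson2000_completeStationaryVacuumFlat`, `Anderson2000_stationaryVacuum_flat`; NOT registered | none |
| final state conjecture WITH RATES (and generically `aᵢ ≠ 0`) | as `P`, plus inverse-polynomial convergence to the Kerr family on the near zones and to Minkowski on the radiation zone | STRICTLY STRONGER (drop the rates); `H ⇒ P` would be a trivial monotonicity, not a printed theorem | Dafermos–Luk Conj. 1 (c) "at an inverse polynomial rate. For generic initial data, `aᵢ ≠ 0`" (stated for the near-Kerr problem; the p. 8 large-data conjecture is printed without rates) | `candidate (not yet in tree)`: typeable with the existing vocabulary (`truncDeviationCk`, `FinalStateDecomposition`) only as a ~40-line variant of the summit body with a rate exponent — outside the skeleton budget and not a NAMED printed conjecture | none |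
| final state statement for ALL admissible data (no genericity) | as `P` with `IsTameChristodoulouGeneric 𝓓 Q 1` replaced by `∀ d ∈ 𝓓, Q d` | STRICTLY STRONGER formally, but conjectured by NOBODY in print (genericity is essential to the accepted formulation: Christodoulou 1999 p. A24, Rodnianski–Shlapentokh-Rothman 2023 naked singularities, extremal end-states) — a hypothesis expected to be refutable would make `H → C` vacuous | — | `candidate (not yet in tree)`, deliberately NOT stated | none |
| final state conjecture for Einstein–Maxwell / Einstein–scalar field / other dimensions | analogous statements for larger systems | INCOMPARABLE (vacuum data form a NON-generic subset of the larger phase space, so genericity does not restrict) | Dafermos–Luk §1; Christodoulou Ann. Math. 149 (1999) (spherical scalar field, PROVED) | `not typeable (missing notion: Einstein–matter Cauchy developments; the prelude `Literature/Geometry/Lorentzian` is vacuum-only apart from the spherically symmetric scalar-field exceptional set in `CosmicCensorship.lean`)` | none |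

Registered: 0. Bridges: 0 landed, 0 printed. Equivalent criteria in print: none.

## Deliberately NOT registered (and why)

* Everything WEAKER / INGREDIENT / INCOMPARABLE in the table: registering an `H` not known to imply `P` would let
  `H → C` certify cruxes that are not summit-strength. In addition the in-tree `WeakCosmicCensorship`,
  `StrongCosmicCensorshipC0/C2` and `SubextremalKerrStabilityConjecture` quantify over the older
  `Development`/`VacuumDevelopment` structure of `Development.lean`, uninhabited by `VacuumDevelopment.isEmpty` (`Development.isEmpty_carrier`)
  (`DevelopmentProofs.lean`; the summit was re-typed over `CauchyDevelopment` for exactly this reason, audit g6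
  B1): as typed they are PROVABLE (vacuously), and a provable `H` makes the probe `H → C` equivalent to proving
  `C` outright — useless rather than unsound, but noise. Follow-up for a literature seat: re-type gr.S02/S04/S22
  over `VacuumCauchyDevelopment` (not done here: no existing file may be edited by this seat, and the re-typed
  statements would still be weaker than / incomparable with the summit).
* Summit-side hypotheses in `Summits/FinalStateConjecture/FinalStateConjecture/Cruxes/**` (e.g.
  `TameCensorship.TriageR2K2.TameCensorshipHypothesis`, `SketchIdeator5.TameCensorshipHypothesis`,
  `SeamedChartsExhaust.SketchIdeator1.RimCriterion`) and the construction targets of negative lemmas in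
  `Theorems/**/Negative` (`TamePocketExists`, `ExistsIncurableTameExit`): route-internal crux material (tame WCC
  is WEAKER than the summit; the negative targets imply the NEGATION of a crux) — never tagged.
* `Theses` decls of the summit's routes (AnalyticInheritance, BartnikGapSettling, BondiDrainDispersal,
  ClusterCompleteness, …): what the tribunal probes; tagging them would be circular.
* Barrier catalogue `Literature/Barriers/FinalStateConjecture/*` (slowly-rotating Kerr frontier, extremal-horizon
  (Aretakis) instability, Kerr superradiance / Klein–Gordon superradiant instability, Gregory–Laflamme, hairy Kerr
  bifurcation, naked-singularity instability, non-smooth null infinity, Price law, trapping derivative loss):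
  no-go / frontier THEOREMS with `technique_class` blocks, not strong hypotheses.

## Not yet typeable

* Final state conjectures for Einstein–matter systems (missing: matter Cauchy developments).
* "Asymptotic stationarity" of generic black-hole exteriors as a stand-alone hypothesis (Penrose's heuristic
  step; would need a notion of asymptotically Killing developments — the tree has `Stationary.lean`,
  `AsymptoticallyStationaryExhaustion.lean` for exactly stationary spacetimes only). Even if typed it is an
  INGREDIENT (with rigidity + Kerr stability + no-solitons), i.e. a route decomposition, not an `H ⇒ P`.

## Sources (all keys in `lean/references.bib`)

[DafermosLuk2017] §1.1.1, §1.2.1 (p. 8), Conjecture 1 (a)–(c), §1.2.4 Conjecture 2, §1.3.3; [Christodoulou1999]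
pp. A24, A26–A28; [Christodoulou2008] Prologue pp. 6–7; [KlainermanSzeftel2023] p. 3; [GiorgiKlainermanSzeftel2022]
p. 23; [DafermosRodnianski2008] Conj. 5.1; [arXiv08110354] §2.6.2, §2.7.3; [arXiv210408222] §1; [Penrose1982]
Problem 12; [Penrose1973]; [Mars2009] §2–3; [ChruscielCosta2008] Conj. 1.2, Thm. 1.3; [AlexakisIonescuKlainerman2010];
[Anderson2000]; [ChristodoulouKlainerman1993]; [RodnianskiShlapentokhRothman2023]; [Sbierski2018] Def. 2.1.
-/

/-! ## Registry: empty (see the census above). The namespace exists so that the pair is uniform. -/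

namespace Literature.StrongHypotheses.FinalStateConjecture

end Literature.StrongHypotheses.FinalStateConjecture
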